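import Literature.AlgebraicGeometry.Shioda1979.Statement
import Mathlib.Data.Nat.Totient
import Mathlib.Data.Nat.Prime.Basic
import Mathlib.NumberTheory.Bertrand
import Mathlib.Tactic.IntervalCases
import HarnessLib

/-!
# Fermat varieties with `rank Hⁿ(Xⁿ_d, ℤ)_alg = h^{n/2,n/2}`: exactly the degrees `d = 1, 2, 3, 4, 6`
# (Duque Franco–Villaflor Loyola, ANT 2023, Proposition 2.2; Beauville 2014, Proposition 11)

J. Duque Franco, R. Villaflor Loyola, *On fake linear cycles inside Fermat varieties*, Algebra & Number
Theory **17** (2023) 1847–1865 = arXiv:2112.14818 [DuquefrancoVillaflorloyola2023], §2 (held text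
`paper:arxiv-2112.14818`, pp. 5–6). Verbatim:

> Curiously Fermat varieties of degrees `d = 3, 4, 6` correspond exactly to those where the group
> `Hⁿ(Xⁿ_d, ℤ)_alg` of algebraic cycles has maximal rank `h^{n/2,n/2}` (see (proppicmax) and
> [beauville2014some] for a survey on these rare to find varieties). [p. 3]
>
> **Proposition 2.2.** For even dimensional Fermat varieties `Xⁿ_d` one has
> `rank Hⁿ(Xⁿ_d, ℤ)_alg = h^{n/2,n/2}` if and only if `φ(d) ≤ 2`, i.e. `d = 1, 2, 3, 4, 6`.
>
> *Proof.* Let us note first that if `φ(d) ≤ 2`, we know the Hodge conjecture by [shioda1979hodge]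
> and so it is enough to show, by (theoshioda) (iii), that for all `α ∈ Ĝⁿ_d` with `|α| = n/2 + 1` one has
> `|t·α| = n/2 + 1 ∀ t ∈ (ℤ/dℤ)^×` (eqpicmax). This is trivial if `φ(d) = 1`, and for `φ(d) = 2` we have
> `(ℤ/dℤ)^× = {1, d−1}` where the result is also clear. Conversely, if `φ(d) > 2` let us construct some
> `α ∈ Ĝⁿ_d` with `|α| = n/2 + 1` not satisfying (eqpicmax). Note that if we find such an `α` for `n = 2`,
> then to construct one for any `n ≥ 4` is easy just adding pairs of entries of the form `(1, d−1)`.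
> Thus we are reduced to the case `n = 2`. Let us consider first the case `d ≠ 5, 9`. By (lemmaent)
> there exists some `k ∈ {2, 3, …, d−1}` such that `d/(k+1) < q < d/k` where
> `q := min{p prime : p ∤ 2d}`. We claim the desired character is any `α = (aq, bq, cq, 2d − (k+1)q)`
> such that `a + b + c = k + 1` with `a, b, c ∈ {1, 2, …, k}`. In fact, `|α| = 2` but if
> `t = q⁻¹ ∈ (ℤ/dℤ)^×` then `|t·α| = |(a, b, c, r)| = (k + 1 + r)/d < 2`. Finally for the cases
> `d = 5, 9` consider the characters `α = (2,2,2,4), (5,5,5,3)` respectively and `t = 2`. □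

Here `Ĝⁿ_d`, `|α| = (1/d) Σ ā_i`, and `𝔅ⁿ_d = {α ∈ Ĝⁿ_d : |t·α| = n/2+1 ∀ t}` are Shioda's [Shioda1979HodgeFermat]
§1 (1.1)–(1.6) (= DF–V Thm 2.1), in the tree `FermatCharacter.IsAdmissible`, `FermatCharacter.normSum`
(`= d·|α|`), `FermatCharacter.IsHodge` and `Shioda1979.hodgeCharacterSet d p` (`𝔅^{2p}_d` verbatim,
`Shioda1979.mem_hodgeCharacterSet_iff`). By Shioda's Theorem I (ii) [Shioda1979HodgeFermat, p. 176] the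
characters `α ∈ 𝔄^{2p}_d` with `|α| = p + 1` index the eigenlines spanning `H^{p,p}_prim(X^{2p}_d)`, and by
Theorem I (iii) those in `𝔅^{2p}_d` index `(H^{p,p} ∩ H^{2p}_prim(X, ℚ)) ⊗ ℂ`; so display (eqpicmax) —
"`𝔅^{2p}_d` is ALL of `{α ∈ 𝔄^{2p}_d : |α| = p+1}`" — is the statement "`H^{p,p}(X^{2p}_d)` is spanned by
rational classes", which for `d ∈ {1,2,3,4,6}` (`d` prime or `4` or `≤ 20`: Hodge conjecture for `Xⁿ_d` known,
[Shioda1979HodgeFermat] Thm. III and Cor. p. 182; tree fact `HodgeTheory.hodgeClasses_algebraic_fermat`) is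
`rank Hⁿ(Xⁿ_d, ℤ)_alg = h^{n/2,n/2}`. A. Beauville, *Some surfaces with maximal Picard number*,
J. Éc. polytech. Math. **1** (2014) 101–116 [Beauville2014]: **Proposition 11** (p. 12) "Let `Fⁿ_d` be the
Fermat hypersurface of degree `d` and even dimension `n = 2ν`. For `d = 3, 4`, the group `Hⁿ(Fⁿ_d, ℤ)_alg` has
maximal rank `h^{ν,ν}`", Corollary 1 (p. 8) "The Fermat sextic surface is `ρ`-maximal" and Remark 1 (the
Fermat quartic surface).

## What this file PROVES (0 facts, 0 sorry; no new definition)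

The combinatorial content (eqpicmax) of Proposition 2.2, in the tree's vocabulary, for every `p ≥ 1`
(`n = 2p ≥ 2`) and every `d ≥ 1`:

* `hodgeCharacterSet_eq_iff` — `𝔅^{2p}_d = {α ∈ 𝔄^{2p}_d : d|α| = d(p+1)}` **iff** `d ∈ {1,2,3,4,6}`;
  `hodgeCharacterSet_eq_iff_totient_le_two` — iff `φ(d) ≤ 2`; `forall_isHodge_iff` (the same with
  `FermatCharacter.IsHodge`); the two directions separately `isHodge_of_normSum_eq` (first half of the printed
  proof: the units are `{1, −1}` and `d|−α| = d(n+2) − d|α|`) and `exists_not_isHodge_of_coprime` (second half).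
* (v2) the dictionary with Griffiths' monomial basis, DFV (griffbasdesc) / Prop. 2.1: `exponentChar d β = (β_i + 1)_i`
  is a bijection from the box exponents `β_i ≤ d − 2` of degree `d(q+1) − (n+2)` onto the admissible characters with
  `d|α| = d(q+1)` (`isAdmissible_exponentChar_iff` — the integrality condition `d ∣ deg x^β + n + 2`;
  `exponentChar_mem_iff`, `exponentChar_val_sub_one`, `exponentChar_injOn`), and Prop. 2.2 in that basis:
  `isHodge_exponentChar` / `forall_isHodge_exponentChar_iff` — every middle-degree box monomial has a Hodge
  character iff `d ∈ {2,3,4,6}` (`d ≥ 2`, `n ≥ 2`).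
* (v3) **Lemma 2.1 as printed** (`least_prime_not_dvd_two_mul`): for `d ≥ 5`, `d ≠ 6`, the least prime `q ∤ 2d`
  has `2q < d`, or `2q = d + 1` with `d ∈ {5, 9}` — by the printed residue-mod-4 argument, with Bertrand's postulate
  making "p_2⋯p_{n−1} quickly becomes bigger than 2p_n − 1" precise.
* `totient_le_two_iff` — "`φ(d) ≤ 2`, i.e. `d = 1,2,3,4,6`" (`d ≥ 1`), through the cycle
  all units `±1` ⇒ no `q` coprime to `d` with `2 ≤ q ≤ d/2` ⇒ `d ∈ {1,2,3,4,6}` ⇒ `φ(d) ≤ 2` ⇒ all units `±1`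
  (`units_eq_one_or_neg_one_of_totient_le_two`, `le_four_or_eq_six_of_forall_not_coprime`,
  `exists_coprime_two_mul_le`).

DEVIATION from the printed proof (a shorter road, same construction): the paper takes `q` = the least prime
not dividing `2d` and needs Lemma 2.1 (`q < d/2` or `q = (d+1)/2`, `d = 5, 9`, via growth of primorials) to
place it; the construction only uses that `q` is a unit of `ℤ/d` with `2 ≤ q ≤ d/2`, and such a `q` exists for
every `d ∉ {1,2,3,4,6}` by parity alone (`d` odd: `q = 2`; `d = 2e`, `e` even: `q = e − 1`; `e` odd:
`q = e − 2`) — `exists_coprime_two_mul_le`. With `k = ⌊d/q⌋ ≥ 2`, `d = kq + s`, `0 < s < q`, the surface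
character is the printed `α = (aq, bq, cq, 2d − (k+1)q)` with `(a,b,c) = (1,1,k−1)`:
`α = q·(1, 1, k−1, −(k+1))`, `d|α| = q + q + (k−1)q + (d − q + s) = 2d`, while `d|q⁻¹α| = 1 + 1 + (k−1) +
(d − k − 1) = d` (for `d = 5` this is the printed `(2,2,2,4)`; for `d = 9` it gives `(2,2,6,8)`, `t = 5`).
Higher `n`: pad with pairs `(1, −1)` exactly as printed (`normSum_pad`).
-/

namespace Literature.AlgebraicGeometry.DuqueFrancoVillaflor2023

open Finset
open Literature.AlgebraicGeometry.HodgeTheory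
open Literature.AlgebraicGeometry.HodgeTheory.FermatCharacter
open Literature.AlgebraicGeometry.Shioda1979

variable {m : ℕ}

/-! ## Arithmetic of `φ(d) ≤ 2` -/

/-- `d ∈ {1,2,3,4,6} ⇒ φ(d) ≤ 2` ("i.e." of Prop. 2.2, one direction).
[cite: DuquefrancoVillaflorloyola2023, Proposition 2.2] -/
theorem totient_le_two_of_mem (h : m = 1 ∨ m = 2 ∨ m = 3 ∨ m = 4 ∨ m = 6) : m.totient ≤ 2 := by
  rcases h with rfl | rfl | rfl | rfl | rfl <;> decide

/-- `φ(d) ≤ 2` forces every unit of `ℤ/d` to be `±1` ("for `φ(d) = 2` we have `(ℤ/dℤ)^× = {1, d−1}`").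
[cite: DuquefrancoVillaflorloyola2023, proof of Proposition 2.2] -/
theorem units_eq_one_or_neg_one_of_totient_le_two [NeZero m] (h : m.totient ≤ 2) (u : (ZMod m)ˣ) :
    (u : ZMod m) = 1 ∨ (u : ZMod m) = -1 := by
  classical
  by_contra hu
  push Not at hu
  rcases Nat.lt_or_ge m 3 with hm | hm
  · -- `m ≤ 2`: every unit is `1`
    have hm0 := NeZero.pos m
    interval_cases m
    · exact hu.1 (Subsingleton.elim _ _)
    · have key : ∀ a b : ZMod 2, a * b = 1 → a = 1 := by decide
      exact hu.1 (key _ _ u.mul_inv)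
  · haveI : Fact (2 < m) := ⟨hm⟩
    have h3 : ({1, -1, u} : Finset (ZMod m)ˣ).card = 3 := by
      rw [Finset.card_eq_three]
      refine ⟨1, -1, u, ?_, ?_, ?_, rfl⟩
      · intro h1
        have h1' := congrArg Units.val h1
        simp only [Units.val_one, Units.val_neg] at h1'
        exact ZMod.neg_one_ne_one h1'.symm
      · intro h1; apply hu.1; rw [← h1, Units.val_one]
      · intro h1; apply hu.2; rw [← h1, Units.val_neg, Units.val_one]
    have hle : ({1, -1, u} : Finset (ZMod m)ˣ).card ≤ Fintype.card (ZMod m)ˣ := Finset.card_le_univ _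
    rw [h3, ZMod.card_units_eq_totient] at hle
    omega

/-- A unit `q` of `ℤ/d` with `2 ≤ q ≤ d/2` is neither `1` nor `−1`.
[cite: DuquefrancoVillaflorloyola2023, proof of Proposition 2.2] -/
theorem natCast_ne_one_and_ne_neg_one [NeZero m] {q : ℕ} (hq : 2 ≤ q) (h2q : 2 * q ≤ m) :
    (q : ZMod m) ≠ 1 ∧ (q : ZMod m) ≠ -1 := by
  have hqm : q < m := by omega
  haveI : Fact (1 < m) := ⟨by omega⟩
  constructor
  · intro h
    have := congrArg ZMod.val h
    rw [ZMod.val_natCast, Nat.mod_eq_of_lt hqm, ZMod.val_one] at this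
    omega
  · intro h
    have := congrArg ZMod.val h
    rw [ZMod.val_natCast, Nat.mod_eq_of_lt hqm, ZMod.neg_val, if_neg one_ne_zero, ZMod.val_one] at this
    omega

/-- If every unit of `ℤ/d` is `±1` there is no `q` coprime to `d` with `2 ≤ q ≤ d/2`.
[cite: DuquefrancoVillaflorloyola2023, proof of Proposition 2.2] -/
theorem forall_not_coprime_of_units [NeZero m]
    (hU : ∀ u : (ZMod m)ˣ, (u : ZMod m) = 1 ∨ (u : ZMod m) = -1) :
    ∀ q, 2 ≤ q → 2 * q ≤ m → ¬ q.Coprime m := by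
  intro q hq h2q hcop
  obtain ⟨h1, h2⟩ := natCast_ne_one_and_ne_neg_one hq h2q
  rcases hU (ZMod.unitOfCoprime q hcop) with h | h
  · exact h1 (by rwa [ZMod.coe_unitOfCoprime] at h)
  · exact h2 (by rwa [ZMod.coe_unitOfCoprime] at h)

/-- The parity road replacing Lemma 2.1: for `d ∉ {0,1,2,3,4,6}` there IS a `q` coprime to `d` with
`2 ≤ q ≤ d/2` — `d` odd: `q = 2`; `d = 2e`, `e` even: `q = e−1`; `e` odd: `q = e−2`. (Contrapositive form.)
[cite: DuquefrancoVillaflorloyola2023, Lemma 2.1 and proof of Proposition 2.2] -/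
theorem le_four_or_eq_six_of_forall_not_coprime
    (h : ∀ q, 2 ≤ q → 2 * q ≤ m → ¬ q.Coprime m) : m ≤ 4 ∨ m = 6 := by
  by_contra hne
  push Not at hne
  obtain ⟨h5, h6⟩ := hne
  rcases Nat.even_or_odd m with ⟨e, he⟩ | hodd
  · -- `m = e + e`
    rcases Nat.even_or_odd e with ⟨f, hf⟩ | ⟨g, hg⟩
    · -- `e` even, `e ≥ 4`: `q = e - 1`
      refine h (e - 1) (by omega) (by omega) ?_
      have h1 : (e - 1).Coprime e := by
        rw [Nat.coprime_self_sub_left (by omega)]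
        exact Nat.coprime_one_left _
      have h2 : (e - 1).Coprime 2 := by
        rw [Nat.coprime_two_right]; exact ⟨f - 1, by omega⟩
      rw [show m = 2 * e by omega]
      exact Nat.Coprime.mul_right h2 h1
    · -- `e` odd, `e ≥ 5`: `q = e - 2`
      refine h (e - 2) (by omega) (by omega) ?_
      have h1 : (e - 2).Coprime e := by
        rw [Nat.coprime_self_sub_left (by omega), Nat.coprime_two_left]
        exact ⟨g, hg⟩
      have h2 : (e - 2).Coprime 2 := by
        rw [Nat.coprime_two_right]; exact ⟨g - 1, by omega⟩
      rw [show m = 2 * e by omega]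
      exact Nat.Coprime.mul_right h2 h1
  · -- `m` odd, `m ≥ 5`: `q = 2`
    exact h 2 le_rfl (by omega) (Nat.coprime_two_left.mpr hodd)

/-- For `d ≥ 1`: `d ∉ {1,2,3,4,6}` ⇒ some `q` coprime to `d` with `2 ≤ q ≤ d/2`.
[cite: DuquefrancoVillaflorloyola2023, Lemma 2.1 and proof of Proposition 2.2] -/
theorem exists_coprime_two_mul_le (hm : 0 < m) (h : ¬ (m = 1 ∨ m = 2 ∨ m = 3 ∨ m = 4 ∨ m = 6)) :
    ∃ q, 2 ≤ q ∧ 2 * q ≤ m ∧ q.Coprime m := by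
  by_contra hq
  push Not at hq
  have := le_four_or_eq_six_of_forall_not_coprime hq
  omega

/-- **"`φ(d) ≤ 2`, i.e. `d = 1, 2, 3, 4, 6`"** (`d ≥ 1`). [cite: DuquefrancoVillaflorloyola2023, Proposition 2.2] -/
theorem totient_le_two_iff [NeZero m] : m.totient ≤ 2 ↔ (m = 1 ∨ m = 2 ∨ m = 3 ∨ m = 4 ∨ m = 6) := by
  refine ⟨fun h => ?_, totient_le_two_of_mem⟩
  by_contra hne
  obtain ⟨q, hq, h2q, hcop⟩ := exists_coprime_two_mul_le (NeZero.pos m) hne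
  exact forall_not_coprime_of_units (units_eq_one_or_neg_one_of_totient_le_two h) q hq h2q hcop

/-- The units of `ℤ/d` are `{1, −1}` iff `d ∈ {1,2,3,4,6}` (`d ≥ 1`).
[cite: DuquefrancoVillaflorloyola2023, proof of Proposition 2.2] -/
theorem forall_units_eq_iff [NeZero m] :
    (∀ u : (ZMod m)ˣ, (u : ZMod m) = 1 ∨ (u : ZMod m) = -1) ↔ (m = 1 ∨ m = 2 ∨ m = 3 ∨ m = 4 ∨ m = 6) := by
  refine ⟨fun hU => ?_, fun h => units_eq_one_or_neg_one_of_totient_le_two (totient_le_two_of_mem h)⟩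
  by_contra hne
  obtain ⟨q, hq, h2q, hcop⟩ := exists_coprime_two_mul_le (NeZero.pos m) hne
  exact forall_not_coprime_of_units hU q hq h2q hcop

/-! ## First half of the printed proof: units `{1, −1}` ⇒ every `(p,p)`-character is a Hodge character -/

/-- "This is trivial if `φ(d) = 1`, and for `φ(d) = 2` we have `(ℤ/dℤ)^× = {1, d−1}` where the result is
also clear": if every unit is `±1`, an admissible character with `2·d|α| = d·r` is a Hodge character
(`d|−α| = d·r − d|α|`, tree lemma `FermatCharacter.normSum_add_normSum_neg`).
[cite: DuquefrancoVillaflorloyola2023, proof of Proposition 2.2] -/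
theorem isHodge_of_units {r : ℕ} [NeZero m] (hU : ∀ u : (ZMod m)ˣ, (u : ZMod m) = 1 ∨ (u : ZMod m) = -1)
    {α : Fin r → ZMod m} (hα : IsAdmissible α) (hn : 2 * normSum α = m * r) : IsHodge α := by
  refine ⟨hα, fun t => ?_⟩
  rcases hU t with h | h
  · simp only [h, one_mul]; exact hn
  · simp only [h, neg_mul, one_mul]
    have h1 : normSum (fun i => -α i) = normSum (-α) := rfl
    have h2 := normSum_add_normSum_neg hα.1
    rw [h1]
    omega

/-- **Prop. 2.2, "if": for `d ∈ {1,2,3,4,6}` every `α ∈ 𝔄` with `2·d|α| = d·r` lies in `𝔅`.**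
[cite: DuquefrancoVillaflorloyola2023, Proposition 2.2] [cite: Beauville2014, Proposition 11] -/
theorem isHodge_of_normSum_eq {r : ℕ} [NeZero m] (hm : m = 1 ∨ m = 2 ∨ m = 3 ∨ m = 4 ∨ m = 6)
    {α : Fin r → ZMod m} (hα : IsAdmissible α) (hn : 2 * normSum α = m * r) : IsHodge α :=
  isHodge_of_units (forall_units_eq_iff.mpr hm) hα hn

/-! ## Second half: a `(p,p)`-character outside `𝔅` from a unit `q ∉ {±1}` -/

/-- `d|(a, α)| = ⟨a⟩ + d|α|`. [folklore] -/
private theorem normSum_cons {r : ℕ} (a : ZMod m) (α : Fin r → ZMod m) :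
    normSum (Fin.cons a α : Fin (r + 1) → ZMod m) = a.val + normSum α := by
  unfold normSum
  rw [Fin.sum_univ_succ]
  simp only [Fin.cons_zero, Fin.cons_succ]

/-- Multiplying `(a, α)` by `t` coordinatewise is `(ta, tα)`. [folklore] -/
private theorem mul_cons {r : ℕ} (t a : ZMod m) (α : Fin r → ZMod m) :
    (fun i => t * (Fin.cons a α : Fin (r + 1) → ZMod m) i) = Fin.cons (t * a) fun i => t * α i := by
  ext i
  refine Fin.cases ?_ (fun j => ?_) i <;> simp

/-- "adding pairs of entries of the form `(1, d−1)`": `d|t·(1, −1, α)| = d + d|t·α|` for every unit `t`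
(`d ≥ 2`). [cite: DuquefrancoVillaflorloyola2023, proof of Proposition 2.2] -/
theorem normSum_pad {r : ℕ} [NeZero m] (hm : 1 < m) (t : (ZMod m)ˣ) (α : Fin r → ZMod m) :
    normSum (fun i => (t : ZMod m) * (Fin.cons 1 (Fin.cons (-1) α) : Fin (r + 2) → ZMod m) i) =
      m + normSum (fun i => (t : ZMod m) * α i) := by
  haveI : Fact (1 < m) := ⟨hm⟩
  have ht0 : (t : ZMod m) ≠ 0 := t.ne_zero
  rw [mul_cons, normSum_cons, mul_cons, normSum_cons, mul_one, mul_neg, mul_one]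
  have := val_add_val_neg ht0
  omega

/-- `(1, −1, α)` is admissible when `α` is (`d ≥ 2`). [cite: DuquefrancoVillaflorloyola2023, proof of Proposition 2.2] -/
theorem isAdmissible_pad {r : ℕ} [NeZero m] (hm : 1 < m) {α : Fin r → ZMod m} (hα : IsAdmissible α) :
    IsAdmissible (Fin.cons 1 (Fin.cons (-1) α) : Fin (r + 2) → ZMod m) := by
  haveI : Fact (1 < m) := ⟨hm⟩
  refine ⟨fun i => ?_, ?_⟩
  · refine Fin.cases ?_ (fun j => ?_) i
    · simp
    · refine Fin.cases ?_ (fun k => ?_) j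
      · simp
      · simpa using hα.1 k
  · rw [Fin.sum_cons, Fin.sum_cons, hα.2]
    ring

/-- **The surface character** (`n = 2`): for `d = kq + s` with `2 ≤ q`, `2 ≤ k`, `s < q`,
`α = (q, q, (k−1)q, −(k+1)q) = q·β`, `β = (1, 1, k−1, −(k+1))`: `α` is admissible with `d|α| = 2d`
(`⟨−(k+1)q⟩ = 2d − (k+1)q = d − q + s`) while `d|β| = d`. This is the printed `(aq, bq, cq, 2d − (k+1)q)`
with `(a, b, c) = (1, 1, k−1)`, and `β = q⁻¹·α` is the printed `t·α = (a, b, c, r)`.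
[cite: DuquefrancoVillaflorloyola2023, proof of Proposition 2.2] -/
theorem surfaceCharacter [NeZero m] {q k s : ℕ} (hq : 2 ≤ q) (hk : 2 ≤ k) (hs : s < q) (hmk : m = k * q + s) :
    IsAdmissible (![(q : ZMod m), (q : ZMod m), (((k - 1) * q : ℕ) : ZMod m), -((((k + 1) * q : ℕ)) : ZMod m)]) ∧
      normSum (![(q : ZMod m), (q : ZMod m), (((k - 1) * q : ℕ) : ZMod m), -((((k + 1) * q : ℕ)) : ZMod m)])
        = 2 * m ∧
      normSum (![(1 : ZMod m), 1, ((k - 1 : ℕ) : ZMod m), -((k + 1 : ℕ) : ZMod m)]) = m ∧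
      (fun i => (q : ZMod m) * (![(1 : ZMod m), 1, ((k - 1 : ℕ) : ZMod m), -((k + 1 : ℕ) : ZMod m)]) i) =
        ![(q : ZMod m), (q : ZMod m), (((k - 1) * q : ℕ) : ZMod m), -((((k + 1) * q : ℕ)) : ZMod m)] := by
  have hkq1 : (k - 1) * q + q = k * q := by
    rw [← add_one_mul, Nat.sub_add_cancel (by omega : 1 ≤ k)]
  have hkq2 : (k + 1) * q = k * q + q := by ring
  have h2k : 2 * k ≤ k * q := by nlinarith
  have hqk : 2 * q ≤ k * q := Nat.mul_le_mul_right q hk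
  have hm4 : 4 ≤ m := by omega
  haveI : Fact (1 < m) := ⟨by omega⟩
  -- the values of the entries
  have v1 : (1 : ZMod m).val = 1 := ZMod.val_one m
  have vq : ((q : ℕ) : ZMod m).val = q := ZMod.val_cast_of_lt (by omega)
  have vk1 : ((k - 1 : ℕ) : ZMod m).val = k - 1 := ZMod.val_cast_of_lt (by omega)
  have vk2 : ((k + 1 : ℕ) : ZMod m).val = k + 1 := ZMod.val_cast_of_lt (by omega)
  have vk1q : (((k - 1) * q : ℕ) : ZMod m).val = (k - 1) * q := ZMod.val_cast_of_lt (by omega)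
  have vk2q : (((k + 1) * q : ℕ) : ZMod m).val = q - s := by
    rw [ZMod.val_natCast, show (k + 1) * q = m + (q - s) by rw [hkq2, hmk]; omega, Nat.add_mod_left,
      Nat.mod_eq_of_lt (by omega)]
  have hne1 : ((k + 1 : ℕ) : ZMod m) ≠ 0 := fun h => by
    have := (ZMod.val_eq_zero _).mpr h; rw [vk2] at this; omega
  have hne2 : (((k + 1) * q : ℕ) : ZMod m) ≠ 0 := fun h => by
    have := (ZMod.val_eq_zero _).mpr h; rw [vk2q] at this; omega
  have hneq : ((q : ℕ) : ZMod m) ≠ 0 := fun h => by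
    have := (ZMod.val_eq_zero _).mpr h; rw [vq] at this; omega
  have hnek1q : (((k - 1) * q : ℕ) : ZMod m) ≠ 0 := fun h => by
    have := (ZMod.val_eq_zero _).mpr h; rw [vk1q] at this; omega
  have vneg1 : (-((k + 1 : ℕ) : ZMod m)).val = m - (k + 1) := by rw [ZMod.neg_val, if_neg hne1, vk2]
  have vneg2 : (-(((k + 1) * q : ℕ) : ZMod m)).val = m - (q - s) := by rw [ZMod.neg_val, if_neg hne2, vk2q]
  have c1 : (((k - 1) * q : ℕ) : ZMod m) = ((k * q : ℕ) : ZMod m) - (q : ZMod m) := by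
    rw [← hkq1]; push_cast; ring
  refine ⟨⟨?_, ?_⟩, ?_, ?_, ?_⟩
  · -- entries non-zero
    intro i
    fin_cases i
    · exact hneq
    · exact hneq
    · exact hnek1q
    · exact neg_ne_zero.mpr hne2
  · -- sum zero
    rw [Fin.sum_univ_four]
    show (q : ZMod m) + (q : ZMod m) + (((k - 1) * q : ℕ) : ZMod m) + -((((k + 1) * q : ℕ)) : ZMod m) = 0
    rw [c1]; push_cast; ring
  · -- `d|α| = 2d`
    rw [normSum, Fin.sum_univ_four]
    show ((q : ℕ) : ZMod m).val + ((q : ℕ) : ZMod m).val + (((k - 1) * q : ℕ) : ZMod m).val +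
      (-((((k + 1) * q : ℕ)) : ZMod m)).val = 2 * m
    rw [vq, vk1q, vneg2]
    omega
  · -- `d|β| = d`
    rw [normSum, Fin.sum_univ_four]
    show (1 : ZMod m).val + (1 : ZMod m).val + ((k - 1 : ℕ) : ZMod m).val + (-((k + 1 : ℕ) : ZMod m)).val = m
    rw [v1, vk1, vneg1]
    omega
  · -- `α = q·β`
    funext i
    fin_cases i
    · exact mul_one _
    · exact mul_one _
    · show (q : ZMod m) * ((k - 1 : ℕ) : ZMod m) = (((k - 1) * q : ℕ) : ZMod m)
      push_cast; ring
    · show (q : ZMod m) * -((k + 1 : ℕ) : ZMod m) = -((((k + 1) * q : ℕ)) : ZMod m)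
      push_cast; ring

/-- **Prop. 2.2, "only if" (the construction): a unit `q` of `ℤ/d` with `2 ≤ q ≤ d/2` yields, for every
`p ≥ 1`, an admissible character `α` on `2p + 2` letters with `d|α| = d(p+1)` (a character of
`H^{p,p}_prim(X^{2p}_d)`) which is NOT a Hodge character: `d|q⁻¹·α| = d·p ≠ d(p+1)`.**
[cite: DuquefrancoVillaflorloyola2023, Proposition 2.2 (proof)] -/
theorem exists_not_isHodge_of_coprime [NeZero m] {q : ℕ} (hq : 2 ≤ q) (h2q : 2 * q ≤ m)
    (hcop : q.Coprime m) {p : ℕ} (hp : 1 ≤ p) :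
    ∃ α : Fin (2 * p + 2) → ZMod m,
      IsAdmissible α ∧ normSum α = m * (p + 1) ∧
        normSum (fun i => (((ZMod.unitOfCoprime q hcop)⁻¹ : (ZMod m)ˣ) : ZMod m) * α i) = m * p ∧
          ¬ IsHodge α := by
  set u : (ZMod m)ˣ := ZMod.unitOfCoprime q hcop with hu_def
  have hu : (u : ZMod m) = q := ZMod.coe_unitOfCoprime q hcop
  have hm1 : 1 < m := by omega
  -- it suffices to produce the first three properties on `4 + 2j` letters
  suffices H : ∀ j : ℕ, ∃ α : Fin (4 + 2 * j) → ZMod m, IsAdmissible α ∧ normSum α = m * (j + 2) ∧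
      normSum (fun i => ((u⁻¹ : (ZMod m)ˣ) : ZMod m) * α i) = m * (j + 1) by
    obtain ⟨j, rfl⟩ : ∃ j, p = j + 1 := ⟨p - 1, by omega⟩
    have e : 2 * (j + 1) + 2 = 4 + 2 * j := by ring
    rw [e]
    obtain ⟨α, h1, h2, h3⟩ := H j
    refine ⟨α, h1, by rw [h2], by rw [h3], fun hH => ?_⟩
    have := hH.2 u⁻¹
    rw [h3] at this
    have hm0 := NeZero.pos m
    ring_nf at this
    omega
  intro j
  induction j with
  | zero =>
    -- the surface character
    obtain ⟨k, s, hk, hs, hmk⟩ : ∃ k s, 2 ≤ k ∧ s < q ∧ m = k * q + s := by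
      refine ⟨m / q, m % q, ?_, Nat.mod_lt _ (by omega), ?_⟩
      · exact (Nat.le_div_iff_mul_le (by omega)).mpr h2q
      · rw [mul_comm]; exact (Nat.div_add_mod m q).symm
    obtain ⟨hadm, hn2, hn1, hfun⟩ := surfaceCharacter (m := m) hq hk hs hmk
    show ∃ α : Fin 4 → ZMod m, _
    refine ⟨_, hadm, by rw [hn2]; ring, ?_⟩
    rw [← hfun]
    have : (fun i => ((u⁻¹ : (ZMod m)ˣ) : ZMod m) * ((q : ZMod m) *
        (![(1 : ZMod m), 1, ((k - 1 : ℕ) : ZMod m), -((k + 1 : ℕ) : ZMod m)]) i)) =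
        ![(1 : ZMod m), 1, ((k - 1 : ℕ) : ZMod m), -((k + 1 : ℕ) : ZMod m)] := by
      funext i
      rw [← hu, ← mul_assoc, Units.inv_mul, one_mul]
    rw [this, hn1]
    ring
  | succ j ih =>
    obtain ⟨α, h1, h2, h3⟩ := ih
    have e : 4 + 2 * (j + 1) = 4 + 2 * j + 2 := by ring
    rw [e]
    refine ⟨Fin.cons 1 (Fin.cons (-1) α), isAdmissible_pad hm1 h1, ?_, ?_⟩
    · have := normSum_pad hm1 1 α
      simp only [Units.val_one, one_mul] at this
      rw [this, h2]; ring
    · rw [normSum_pad hm1 u⁻¹ α, h3]; ring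

/-! ## Proposition 2.2 -/

/-- `𝔅^{2p}_d ⊆ {α ∈ 𝔄 : d|α| = d(p+1)}` always (take `t = 1` in (1.6)).
[cite: Shioda1979HodgeFermat, §1 (1.6), p. 176] -/
theorem hodgeCharacterSet_subset (m p : ℕ) :
    hodgeCharacterSet m p ⊆ {α | IsAdmissible α ∧ normSum α = m * (p + 1)} := by
  intro α hα
  refine ⟨hα.1, ?_⟩
  have := hα.2 1
  simpa using this

/-- **Proposition 2.2 (display (eqpicmax)): for `n = 2p ≥ 2` and `d ≥ 1`,
`𝔅ⁿ_d = {α ∈ 𝔄ⁿ_d : |α| = n/2 + 1}` — every character of `H^{n/2,n/2}_prim(Xⁿ_d)` is a Hodge character —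
if and only if `d ∈ {1, 2, 3, 4, 6}`.** With Shioda's Theorem I (ii)–(iii) and the Hodge conjecture for
these `Xⁿ_d` this reads "`rank Hⁿ(Xⁿ_d, ℤ)_alg = h^{n/2,n/2}` iff `d = 1, 2, 3, 4, 6`".
[cite: DuquefrancoVillaflorloyola2023, Proposition 2.2] [cite: Beauville2014, Proposition 11 and Corollary 1] -/
theorem hodgeCharacterSet_eq_iff [NeZero m] {p : ℕ} (hp : 1 ≤ p) :
    hodgeCharacterSet m p = {α | IsAdmissible α ∧ normSum α = m * (p + 1)} ↔
      (m = 1 ∨ m = 2 ∨ m = 3 ∨ m = 4 ∨ m = 6) := by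
  constructor
  · intro h
    by_contra hne
    obtain ⟨q, hq, h2q, hcop⟩ := exists_coprime_two_mul_le (NeZero.pos m) hne
    obtain ⟨α, hadm, hn, -, hnot⟩ := exists_not_isHodge_of_coprime hq h2q hcop hp
    have hmem : α ∈ hodgeCharacterSet m p := by rw [h]; exact ⟨hadm, hn⟩
    exact hnot ((mem_hodgeCharacterSet_iff α).mp hmem)
  · intro hm
    refine Set.Subset.antisymm (hodgeCharacterSet_subset m p) fun α hα => ?_
    have hα' : IsAdmissible α ∧ normSum α = m * (p + 1) := hα
    rw [mem_hodgeCharacterSet_iff]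
    exact isHodge_of_normSum_eq hm hα'.1 (by rw [hα'.2]; ring)

/-- **Proposition 2.2 with `φ`: `𝔅ⁿ_d = {α ∈ 𝔄ⁿ_d : |α| = n/2 + 1}` iff `φ(d) ≤ 2`** (`n = 2p ≥ 2`, `d ≥ 1`).
[cite: DuquefrancoVillaflorloyola2023, Proposition 2.2] -/
theorem hodgeCharacterSet_eq_iff_totient_le_two [NeZero m] {p : ℕ} (hp : 1 ≤ p) :
    hodgeCharacterSet m p = {α | IsAdmissible α ∧ normSum α = m * (p + 1)} ↔ m.totient ≤ 2 := by
  rw [hodgeCharacterSet_eq_iff hp, totient_le_two_iff]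

/-- The same in terms of `FermatCharacter.IsHodge`: every admissible `α` on `2p + 2` letters with
`d|α| = d(p+1)` is a Hodge character iff `d ∈ {1,2,3,4,6}` (`p ≥ 1`, `d ≥ 1`).
[cite: DuquefrancoVillaflorloyola2023, Proposition 2.2] -/
theorem forall_isHodge_iff [NeZero m] {p : ℕ} (hp : 1 ≤ p) :
    (∀ α : Fin (2 * p + 2) → ZMod m, IsAdmissible α → normSum α = m * (p + 1) → IsHodge α) ↔
      (m = 1 ∨ m = 2 ∨ m = 3 ∨ m = 4 ∨ m = 6) := by
  rw [← hodgeCharacterSet_eq_iff hp]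
  constructor
  · intro h
    refine Set.Subset.antisymm (hodgeCharacterSet_subset m p) fun α hα => ?_
    have hα' : IsAdmissible α ∧ normSum α = m * (p + 1) := hα
    rw [mem_hodgeCharacterSet_iff]
    exact h α hα'.1 hα'.2
  · intro h α hadm hn
    have : α ∈ hodgeCharacterSet m p := by rw [h]; exact ⟨hadm, hn⟩
    exact (mem_hodgeCharacterSet_iff α).mp this

/-- … and for ALL even dimensions `n ≥ 2` at once ("for even dimensional Fermat varieties `Xⁿ_d`").
[cite: DuquefrancoVillaflorloyola2023, Proposition 2.2] -/
theorem forall_forall_isHodge_iff [NeZero m] :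
    (∀ p : ℕ, 1 ≤ p → ∀ α : Fin (2 * p + 2) → ZMod m,
        IsAdmissible α → normSum α = m * (p + 1) → IsHodge α) ↔
      (m = 1 ∨ m = 2 ∨ m = 3 ∨ m = 4 ∨ m = 6) :=
  ⟨fun h => (forall_isHodge_iff le_rfl).mp (h 1 le_rfl), fun hm _ hp => (forall_isHodge_iff hp).mpr hm⟩

/-- With `φ`: every `(p,p)`-character of every even-dimensional `Xⁿ_d` (`n ≥ 2`) is a Hodge character iff
`φ(d) ≤ 2`. [cite: DuquefrancoVillaflorloyola2023, Proposition 2.2] -/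
theorem forall_forall_isHodge_iff_totient_le_two [NeZero m] :
    (∀ p : ℕ, 1 ≤ p → ∀ α : Fin (2 * p + 2) → ZMod m,
        IsAdmissible α → normSum α = m * (p + 1) → IsHodge α) ↔ m.totient ≤ 2 := by
  rw [forall_forall_isHodge_iff, totient_le_two_iff]

/-- The printed exceptional witnesses: `d = 5`, `α = (2,2,2,4)`, `t = 2` and `d = 9`, `α = (5,5,5,3)`,
`t = 2` are `(1,1)`-characters of the Fermat surface outside `𝔅²_d` (kernel check: `d|α| = 2d`,
`d|2α| ≠ 2d`). [cite: DuquefrancoVillaflorloyola2023, proof of Proposition 2.2 (cases d = 5, 9)] -/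
theorem printed_witnesses :
    (IsAdmissible (![2, 2, 2, 4] : Fin 4 → ZMod 5) ∧ normSum (![2, 2, 2, 4] : Fin 4 → ZMod 5) = 5 * 2 ∧
      normSum (fun i => (2 : ZMod 5) * (![2, 2, 2, 4] : Fin 4 → ZMod 5) i) ≠ 5 * 2) ∧
    (IsAdmissible (![5, 5, 5, 3] : Fin 4 → ZMod 9) ∧ normSum (![5, 5, 5, 3] : Fin 4 → ZMod 9) = 9 * 2 ∧
      normSum (fun i => (2 : ZMod 9) * (![5, 5, 5, 3] : Fin 4 → ZMod 9) i) ≠ 9 * 2) := by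
  refine ⟨⟨⟨by decide, by decide⟩, by decide, by decide⟩, ⟨⟨by decide, by decide⟩, by decide, by decide⟩⟩

/-! ## The dictionary with Griffiths' monomial basis (Prop. 2.1): box exponents ↔ characters

DFV §2, (griffbasdesc) and Prop. 2.1 (held text p. 5), verbatim: "In the particular case of the Fermat variety one
has `Hⁿ_dR(Xⁿ_d)_prim = ⊕_β ℂ·ω_β` where `ω_β = res(x^β Ω / F^{n/2+1})` and `β = (β_0, …, β_{n+1})` with
`β_i ∈ {0, …, d−2}` such that `(1/d)(deg(x^β) + n + 2) ∈ ℤ`. […] **Proposition 2.1.** Let `α = (a_0, …, a_{n+1}) ∈ Ĝⁿ_d`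
be such that `a_0⋯a_{n+1} ≠ 0`, then `V(α) = ℂ·ω_β` where `β_i = ā_i − 1` for all `i = 0, …, n+1`. In particular
for any polynomial `P ∈ R^F_{(d−2)(n/2+1)}`: `ω_P ∈ (H^{n/2,n/2}(Xⁿ_d)_prim ∩ Hⁿ(Xⁿ_d, ℤ)) ⊗ ℂ` if and only if
`P ∈ ⊕_{α ∈ 𝔅ⁿ_d, V(α) = ℂ·ω_β} ℂ·x^β`. *Proof.* […] `g^*ω_β = ζ_d^{Σ_j (β_j+1)c_j} ω_β = α(g) ω_β`. □"

The map `β ↦ α = (β_i + 1 mod d)_i` is the dictionary between Movasati's box monomials `x^β`, `β_i ≤ d − 2` (the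
census language, tree `Movasati2016.PeriodMatrixRank`) and Shioda's characters; below it is proved to be a
bijection from the box exponents of degree `d(q+1) − (n+2)` onto the admissible characters with `d|α| = d(q+1)`
(Thm. 2.1 (ii): Hodge type `(n−q, q)`), so that Prop. 2.2 reads: every middle-degree box monomial `x^β`
(`deg = (d−2)(n/2+1)`) has `α ∈ 𝔅ⁿ_d` iff `d ∈ {1,2,3,4,6}`. The transcendental content of Prop. 2.1 (residues,
`V(α) = ℂ·ω_β`) is not formalised. -/

/-- The character of the residue form `ω_β`: `α_i = β_i + 1 (mod d)` ("`β_i = ā_i − 1`").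
[cite: DuquefrancoVillaflorloyola2023, Proposition 2.1] -/
def exponentChar (d : ℕ) {r : ℕ} (β : Fin r → ℕ) : Fin r → ZMod d := fun i => ((β i + 1 : ℕ) : ZMod d)

/-- `⟨α_i⟩ = β_i + 1` on the box `β_i ≤ d − 2`. [cite: DuquefrancoVillaflorloyola2023, Proposition 2.1] -/
theorem val_exponentChar {d r : ℕ} {β : Fin r → ℕ} (hβ : ∀ i, β i + 1 < d) (i : Fin r) :
    (exponentChar d β i).val = β i + 1 :=
  ZMod.val_cast_of_lt (hβ i)

/-- On the box all `α_i ≠ 0` ("`a_0⋯a_{n+1} ≠ 0`"). [cite: DuquefrancoVillaflorloyola2023, Proposition 2.1] -/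
theorem exponentChar_ne_zero {d r : ℕ} {β : Fin r → ℕ} (hβ : ∀ i, β i + 1 < d) (i : Fin r) :
    exponentChar d β i ≠ 0 := by
  intro h
  have := congrArg ZMod.val h
  rw [val_exponentChar hβ, ZMod.val_zero] at this
  omega

/-- `d|α| = deg x^β + (n + 2)` on the box. [cite: DuquefrancoVillaflorloyola2023, Proposition 2.1] -/
theorem normSum_exponentChar {d r : ℕ} {β : Fin r → ℕ} (hβ : ∀ i, β i + 1 < d) :
    normSum (exponentChar d β) = (∑ i, β i) + r := by
  unfold normSum
  simp_rw [val_exponentChar hβ]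
  rw [Finset.sum_add_distrib, Finset.sum_const, Finset.card_univ, Fintype.card_fin, smul_eq_mul, mul_one]

/-- (griffbasdesc): on the box, `α` is a character of `Ĝⁿ_d` (`Σ α_i = 0`, all `α_i ≠ 0`) iff
`d ∣ deg x^β + n + 2`. [cite: DuquefrancoVillaflorloyola2023, §2 eq. (griffbasdesc) and Proposition 2.1] -/
theorem isAdmissible_exponentChar_iff {d r : ℕ} [NeZero d] {β : Fin r → ℕ} (hβ : ∀ i, β i + 1 < d) :
    IsAdmissible (exponentChar d β) ↔ d ∣ (∑ i, β i) + r := by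
  rw [IsAdmissible, and_iff_right (exponentChar_ne_zero hβ), ← natCast_normSum, normSum_exponentChar hβ,
    ZMod.natCast_eq_zero_iff]

/-- **The dictionary in Hodge level `q`**: a box exponent `β` gives an admissible character with `d|α| = d(q+1)`
iff `deg x^β = d(q+1) − (n+2)` (Thm. 2.1 (ii): `ω_β ∈ H^{n−q,q}`); for the middle degree `(d−2)(n/2+1)`,
`q = n/2`. [cite: DuquefrancoVillaflorloyola2023, Proposition 2.1 and Theorem 2.1 (ii)] -/
theorem exponentChar_mem_iff {d r : ℕ} [NeZero d] {β : Fin r → ℕ} (hβ : ∀ i, β i + 1 < d) (q : ℕ) :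
    exponentChar d β ∈ {α : Fin r → ZMod d | IsAdmissible α ∧ normSum α = d * (q + 1)} ↔
      (∑ i, β i) + r = d * (q + 1) := by
  rw [Set.mem_setOf_eq, isAdmissible_exponentChar_iff hβ, normSum_exponentChar hβ]
  exact ⟨fun h => h.2, fun h => ⟨⟨q + 1, h⟩, h⟩⟩

/-- The inverse dictionary `α ↦ β = (⟨α_i⟩ − 1)_i` inverts `exponentChar` on admissible characters:
`exponentChar d (⟨α_i⟩ − 1) = α`.
[cite: DuquefrancoVillaflorloyola2023, Proposition 2.1] -/
theorem exponentChar_val_sub_one {d r : ℕ} [NeZero d] {α : Fin r → ZMod d} (hα : ∀ i, α i ≠ 0) :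
    exponentChar d (fun i => (α i).val - 1) = α := by
  funext i
  have h0 : (α i).val ≠ 0 := (ZMod.val_ne_zero (α i)).mpr (hα i)
  rw [exponentChar, Nat.sub_add_cancel (by omega), ZMod.natCast_zmod_val]

/-- The inverse exponent lies in the box: `⟨α_i⟩ − 1 + 1 < d` when `α_i ≠ 0`. [cite: DuquefrancoVillaflorloyola2023, Proposition 2.1] -/
theorem val_sub_one_mem_box {d r : ℕ} [NeZero d] {α : Fin r → ZMod d} (hα : ∀ i, α i ≠ 0) (i : Fin r) :
    (α i).val - 1 + 1 < d := by
  have h0 : (α i).val ≠ 0 := (ZMod.val_ne_zero (α i)).mpr (hα i)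
  have := ZMod.val_lt (α i)
  omega

/-- `exponentChar` is injective on the box. [cite: DuquefrancoVillaflorloyola2023, Proposition 2.1] -/
theorem exponentChar_injOn {d r : ℕ} {β β' : Fin r → ℕ} (hβ : ∀ i, β i + 1 < d) (hβ' : ∀ i, β' i + 1 < d)
    (h : exponentChar d β = exponentChar d β') : β = β' := by
  funext i
  have := congrArg (fun α : Fin r → ZMod d => (α i).val) h
  simp only [val_exponentChar hβ, val_exponentChar hβ'] at this
  omega

/-- **Prop. 2.2 in the monomial basis: for `d ∈ {1,2,3,4,6}`, every box monomial of the middle degree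
`(d−2)(n/2+1)` has a HODGE character** (`ω_β` lies in the span of the rational `(n/2,n/2)`-classes).
[cite: DuquefrancoVillaflorloyola2023, Propositions 2.1 and 2.2] -/
theorem isHodge_exponentChar {d : ℕ} [NeZero d] (hd : d = 1 ∨ d = 2 ∨ d = 3 ∨ d = 4 ∨ d = 6) {p : ℕ}
    {β : Fin (2 * p + 2) → ℕ} (hβ : ∀ i, β i + 1 < d) (hdeg : (∑ i, β i) = (d - 2) * (p + 1)) :
    IsHodge (exponentChar d β) := by
  have hmem := (exponentChar_mem_iff hβ p).mpr (by
    rw [hdeg]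
    have : 2 ≤ d := by have := hβ ⟨0, by omega⟩; omega
    zify [this]; ring)
  exact isHodge_of_normSum_eq hd hmem.1 (by rw [hmem.2]; ring)

/-- **Prop. 2.2 in the monomial basis, both directions** (`n = 2p ≥ 2`, `d ≥ 2`): every box exponent `β`
(`β_i ≤ d − 2`) of the middle degree `(d−2)(p+1)` has `α(β) ∈ 𝔅ⁿ_d` iff `d ∈ {2, 3, 4, 6}` — through the
bijection `β ↔ α` with the character form `forall_isHodge_iff`.
[cite: DuquefrancoVillaflorloyola2023, Propositions 2.1 and 2.2] -/
theorem forall_isHodge_exponentChar_iff {d : ℕ} [NeZero d] (hd2 : 2 ≤ d) {p : ℕ} (hp : 1 ≤ p) :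
    (∀ β : Fin (2 * p + 2) → ℕ, (∀ i, β i + 1 < d) → (∑ i, β i) = (d - 2) * (p + 1) → IsHodge (exponentChar d β)) ↔
      (d = 2 ∨ d = 3 ∨ d = 4 ∨ d = 6) := by
  constructor
  · intro h
    have key : d = 1 ∨ d = 2 ∨ d = 3 ∨ d = 4 ∨ d = 6 := by
      refine (forall_isHodge_iff hp).mp fun α hadm hn => ?_
      have hb := val_sub_one_mem_box hadm.1
      have hβ := h (fun i => (α i).val - 1) hb ?_
      · rwa [exponentChar_val_sub_one hadm.1] at hβ
      · have hns := normSum_exponentChar (d := d) hb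
        rw [exponentChar_val_sub_one hadm.1, hn] at hns
        zify [hd2] at hns ⊢
        linarith
    omega
  · intro hd β hβ hdeg
    exact isHodge_exponentChar (by omega) hβ hdeg

/-! ## Lemma 2.1 as printed: the least prime not dividing `2d`

> **Lemma 2.1.** Let `d ≥ 5` and `d ≠ 6` be an integer. Consider `q := min{p prime : p ∤ 2d}`. Then `q < d/2` or
> `q = (d+1)/2`. The second case only holds for `d = 5, 9`.
> *Proof.* If `d = 4k`, then `gcd(2d, d/2 − 1) = 1`, and therefore every prime `p | d/2 − 1` satisfies that
> `p ∤ 2d` and `p < d/2`. Similarly, if `d = 4k+2`, then `gcd(2d, d/2 − 2) = 1` and we can take `p | d/2 − 2`. If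
> `d = 4k+3`, then `gcd(2d, (d−1)/2) = 1` and we can take `p | (d−1)/2`. If `d = 4k+1`, then `gcd(2d, (d+1)/2) = 1`
> and so taking `p | (d+1)/2` we conclude that `q ≤ (d+1)/2`, i.e. `q ≤ (d+1)/2 − 1 < d/2` unless `q = (d+1)/2`.
> To see that this only happens for `d = 5, 9` note that if `q = p_n` is the `n`-th prime number, then
> `p_2⋯p_{n−1} | d = 2p_n − 1`. One sees that `p_2⋯p_{n−1}` quickly becomes bigger than `2p_n − 1` for `n ≥ 4`. □

Below `q` is `Nat.find` of "prime and `∤ 2d`"; "quickly becomes bigger" is made precise with Bertrand's postulate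
(Mathlib `Nat.exists_prime_lt_and_le_two_mul`) twice: for `d = 4k+1`, `k ≥ 7`, the primes `p₁ ∈ (k, 2k]` and
`p₂ ∈ (⌊k/2⌋, 2⌊k/2⌋]` are odd, `< q`, hence divide `d`, and `p₁p₂ > 4k+1 = d`; `k ∈ {3,4,5,6}` (`d = 13, 17, 21, 25`)
are checked directly (`3 ∤ 26`, `3 ∤ 34`, `5 ∤ 42`, `3 ∤ 50`). (Prop. 2.2 above does not use this lemma — see the
module doc — but it is the paper's road, reused in its Prop. 5.2.) -/

/-- There is a prime not dividing `2d` (`d ≥ 1`), so `q := min{p prime : p ∤ 2d}` exists.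
[cite: DuquefrancoVillaflorloyola2023, Lemma 2.1] -/
theorem exists_prime_not_dvd_two_mul {d : ℕ} (hd : 0 < d) : ∃ p, p.Prime ∧ ¬ p ∣ 2 * d := by
  obtain ⟨p, hle, hp⟩ := Nat.exists_infinite_primes (2 * d + 1)
  exact ⟨p, hp, fun h => by have := Nat.le_of_dvd (by omega) h; omega⟩

/-- An odd number `≠ 1` has an odd prime factor. [folklore] -/
private theorem exists_odd_prime_dvd {t : ℕ} (ht1 : t ≠ 1) (hodd : Odd t) : ∃ p, p.Prime ∧ p ∣ t ∧ p ≠ 2 := by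
  obtain ⟨p, hp, hpt⟩ := Nat.exists_prime_and_dvd ht1
  refine ⟨p, hp, hpt, ?_⟩
  rintro rfl
  exact (Nat.not_even_iff_odd.mpr hodd) (even_iff_two_dvd.mpr hpt)

/-- A prime dividing `4` is `2`. [folklore] -/
private theorem eq_two_of_dvd_four {p : ℕ} (hp : p.Prime) (h : p ∣ 4) : p = 2 := by
  rw [show (4 : ℕ) = 2 * 2 from rfl, hp.dvd_mul, or_self] at h
  exact (Nat.prime_dvd_prime_iff_eq hp Nat.prime_two).mp h

/-- **Lemma 2.1** (Duque Franco–Villaflor): for `d ≥ 5`, `d ≠ 6`, the least prime `q` not dividing `2d` satisfies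
`q < d/2` (i.e. `2q < d`), or `q = (d+1)/2` and then `d ∈ {5, 9}`.
[cite: DuquefrancoVillaflorloyola2023, Lemma 2.1] -/
theorem least_prime_not_dvd_two_mul {d : ℕ} (hd5 : 5 ≤ d) (hd6 : d ≠ 6) (h : ∃ p, p.Prime ∧ ¬ p ∣ 2 * d) :
    2 * Nat.find h < d ∨ (2 * Nat.find h = d + 1 ∧ (d = 5 ∨ d = 9)) := by
  set q := Nat.find h with hq_def
  have hq : q.Prime ∧ ¬ q ∣ 2 * d := Nat.find_spec h
  have hqmin : ∀ p, p.Prime → ¬ p ∣ 2 * d → q ≤ p := fun p hp hnd => Nat.find_min' h ⟨hp, hnd⟩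
  -- an odd `t ≠ 1` all of whose odd prime factors avoid `2d` bounds `q`
  have bound : ∀ t, t ≠ 1 → Odd t → (∀ p, p.Prime → p ∣ t → p ≠ 2 → ¬ p ∣ 2 * d) → q ≤ t := by
    intro t ht1 hodd hgood
    obtain ⟨p, hp, hpt, hp2⟩ := exists_odd_prime_dvd ht1 hodd
    exact le_trans (hqmin p hp (hgood p hp hpt hp2)) (Nat.le_of_dvd hodd.pos hpt)
  obtain ⟨k, hk | hk | hk | hk⟩ : ∃ k, d = 4 * k ∨ d = 4 * k + 1 ∨ d = 4 * k + 2 ∨ d = 4 * k + 3 :=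
    ⟨d / 4, by omega⟩
  · -- `d = 4k`: `t = d/2 − 1 = 2k − 1`, `2d = 4(t + 1)`
    left
    have hb := bound (2 * k - 1) (by omega) ⟨k - 1, by omega⟩ fun p hp hpt hp2 h2d => by
      rw [show 2 * d = 4 * ((2 * k - 1) + 1) by omega, hp.dvd_mul] at h2d
      rcases h2d with h4 | h1
      · exact hp2 (eq_two_of_dvd_four hp h4)
      · exact hp.ne_one (Nat.dvd_one.mp ((Nat.dvd_add_right hpt).mp h1))
    omega
  · -- `d = 4k+1`: `t = (d+1)/2 = 2k + 1`, `2d = 2(2t − 1)`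
    have hb := bound (2 * k + 1) (by omega) ⟨k, by omega⟩ fun p hp hpt hp2 h2d => by
      rw [show 2 * d = 2 * (2 * (2 * k + 1) - 1) by omega, hp.dvd_mul] at h2d
      rcases h2d with h2 | h1
      · exact hp2 ((Nat.prime_dvd_prime_iff_eq hp Nat.prime_two).mp h2)
      · have h2t : p ∣ 2 * (2 * k + 1) := Dvd.dvd.mul_left hpt 2
        have := Nat.dvd_sub h2t h1
        rw [show 2 * (2 * k + 1) - (2 * (2 * k + 1) - 1) = 1 by omega] at this
        exact hp.ne_one (Nat.dvd_one.mp this)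
    rcases Nat.lt_or_ge q (2 * k + 1) with hlt | hge
    · left; omega
    · right
      have hqe : q = 2 * k + 1 := le_antisymm hb hge
      refine ⟨by omega, ?_⟩
      by_contra hne
      have hk3 : 3 ≤ k := by omega
      -- every prime `< q` divides `2d`
      have hdiv : ∀ p, p.Prime → p < q → p ∣ 2 * d := fun p hp hlt => by
        by_contra hnd; exact absurd (hqmin p hp hnd) (by omega)
      rcases Nat.lt_or_ge k 7 with hk7 | hk7
      · -- `d ∈ {13, 17, 21, 25}`
        interval_cases k
        · exact absurd (hdiv 3 Nat.prime_three (by omega)) (by rw [hk]; decide)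
        · exact absurd (hdiv 3 Nat.prime_three (by omega)) (by rw [hk]; decide)
        · exact absurd (hdiv 5 (by norm_num) (by omega)) (by rw [hk]; decide)
        · exact absurd (hdiv 3 Nat.prime_three (by omega)) (by rw [hk]; decide)
      · -- Bertrand twice
        obtain ⟨p₁, hp₁, hkp₁, hp₁k⟩ := Nat.exists_prime_lt_and_le_two_mul k (by omega)
        obtain ⟨p₂, hp₂, hkp₂, hp₂k⟩ := Nat.exists_prime_lt_and_le_two_mul (k / 2) (by omega)
        have hodd_dvd : ∀ p, p.Prime → p ≠ 2 → p ∣ 2 * d → p ∣ d := fun p hp hp2 hpd => by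
          rcases (hp.dvd_mul).mp hpd with h2 | h
          · exact absurd ((Nat.prime_dvd_prime_iff_eq hp Nat.prime_two).mp h2) hp2
          · exact h
        have h₁ : p₁ ∣ d := hodd_dvd p₁ hp₁ (by omega) (hdiv p₁ hp₁ (by omega))
        have h₂ : p₂ ∣ d := hodd_dvd p₂ hp₂ (by omega) (hdiv p₂ hp₂ (by omega))
        have hne12 : p₁ ≠ p₂ := by omega
        have hcop : p₁.Coprime p₂ := (Nat.coprime_primes hp₁ hp₂).mpr hne12
        have hprod : p₁ * p₂ ∣ d := Nat.Coprime.mul_dvd_of_dvd_of_dvd hcop h₁ h₂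
        have hle : p₁ * p₂ ≤ d := Nat.le_of_dvd (by omega) hprod
        have : (k + 1) * (k / 2 + 1) ≤ p₁ * p₂ := Nat.mul_le_mul (by omega) (by omega)
        have hk2 : k ≤ 2 * (k / 2) + 1 := by omega
        nlinarith
  · -- `d = 4k+2` (`k ≥ 2` since `d ≠ 6`): `t = d/2 − 2 = 2k − 1`, `2d = 4(t + 2)`
    left
    have hb := bound (2 * k - 1) (by omega) ⟨k - 1, by omega⟩ fun p hp hpt hp2 h2d => by
      rw [show 2 * d = 4 * ((2 * k - 1) + 2) by omega, hp.dvd_mul] at h2d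
      rcases h2d with h4 | h1
      · exact hp2 (eq_two_of_dvd_four hp h4)
      · exact hp2 ((Nat.prime_dvd_prime_iff_eq hp Nat.prime_two).mp ((Nat.dvd_add_right hpt).mp h1))
    omega
  · -- `d = 4k+3`: `t = (d−1)/2 = 2k + 1`, `2d = 2(2t + 1)`
    left
    have hb := bound (2 * k + 1) (by omega) ⟨k, by omega⟩ fun p hp hpt hp2 h2d => by
      rw [show 2 * d = 2 * (2 * (2 * k + 1) + 1) by omega, hp.dvd_mul] at h2d
      rcases h2d with h2 | h1
      · exact hp2 ((Nat.prime_dvd_prime_iff_eq hp Nat.prime_two).mp h2)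
      · exact hp.ne_one (Nat.dvd_one.mp ((Nat.dvd_add_right (Dvd.dvd.mul_left hpt 2)).mp h1))
    omega

/-- The printed exceptional cases are genuine: for `d = 5` the least prime not dividing `10` is `3 = (5+1)/2`, and
for `d = 9` the least prime not dividing `18` is `5 = (9+1)/2` (kernel check of the two facts used).
[cite: DuquefrancoVillaflorloyola2023, Lemma 2.1] -/
theorem least_prime_not_dvd_two_mul_examples :
    (¬ 3 ∣ 2 * 5 ∧ (2 ∣ 2 * 5) ∧ 2 * 3 = 5 + 1) ∧ (¬ 5 ∣ 2 * 9 ∧ (2 ∣ 2 * 9 ∧ 3 ∣ 2 * 9) ∧ 2 * 5 = 9 + 1) := by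
  decide

end Literature.AlgebraicGeometry.DuqueFrancoVillaflor2023
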